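import Mathlib
import HarnessLib
import Literature.Probability.Independence.Grouping
import Summits.Ventures.LatticeQCDFlow.Scoring.UStatisticVarianceIntegral
import Summits.Ventures.LatticeQCDFlow.Scoring.ReplicaChains

/-!
# The median of the block U-statistics of ONE i.i.d. stream: `R` disjoint blocks of `m` draws,
# radius `2√(Var U_m)` driven by the U-statistic's own variance, confidence `1 − e^{−R/8}`,
# no boundedness of the kernel

HONEST FRAMING: exact (Metropolis-corrected) sampling algorithms for lattice gauge theory;
figures of merit are autocorrelation/cost numbers at stated couplings and volumes; no
continuum-physics claim.

Venture `LatticeQCDFlow` (cell pub-lqcd), topic `Scoring`; FANOUT row 4 (`s0-u1-b`, rung S0-B: two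
independent codes A, B for the 2D U(1) flow sampler; acceptance test "A vs B within 3 pp").
Row 4's `Scoring/AllPairsAcceptance` certified the all-pairs (order-2 U-statistic) estimate of the
acceptance with HOEFFDING's exponent `2⌊n/2⌋t²/W²` — a RANGE bound: the weight ceiling `W` sets the
radius — and left "Arcones–Giné-type bounds with the U-statistic's own (smaller) variance" NOT
CLAIMED.  This file gives the cheapest variance-driven exponential certificate, for ANY symmetric
kernel `F ∈ L²(ν ⊗ ν)` on ANY measurable space and with NO boundedness: cut the stream of `n`
independent draws with common law `ν` into `R` consecutive disjoint blocks of `m` draws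
(`R·m ≤ n`), compute the order-2 U-statistic `U_r` of each block, and read the MEDIAN.  Each `U_r`
has Hoeffding's exact variance `V_m = (2ζ₂ + 4(m − 2)ζ₁)/(m(m − 1))` (row 3's
`Scoring/UStatisticVarianceIntegral`, imported), so Chebyshev puts it within `t` of `μ_F` with
probability `≥ 3/4` as soon as `4V_m ≤ t²`; the `U_r` are INDEPENDENT (grouping of independent
σ-fields along disjoint blocks, the tree's `Literature…Independence.iIndepFun_comp_of_pairwise_disjoint`,
Kallenberg Cor. 3.7); and Hoeffding's inequality for the independent indicators "block `r` is bad"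
(Mathlib's `HasSubgaussianMGF.measure_sum_ge_le_of_iIndepFun`) makes "at least half the blocks are
bad" an event of probability `≤ e^{−R/8}` — on its complement every sample median of
`U_0, …, U_{R−1}` is within `t` of `μ_F`.

Printed counterpart NAMED ONLY (our statement is elementary and carries its own constants): the
median-of-means estimator (Nemirovsky–Yudin 1983; Devroye–Lerasle–Lugosi–Oliveira, Ann. Statist. 44,
2016) and its U-statistic form with "diagonal blocks" — Joly–Lugosi, *Robust estimation of
U-statistics*, Stoch. Proc. Appl. 126 (2016) §2 ("one may simply calculate the median of the `V`
different U-statistics `U_{B_i}(h)`; this version is easy to analyze because `|{i : U_{B_i}(h) ≥ b}|`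
is a sum of independent random variables"); Laforgue–Clémençon–Bertail, *On medians of (randomized)
pairwise means*, ICML 2019, Prop. 2 (the "MoU" estimator `median(Û_1, …, Û_K)` over a partition into
`K ≈ (9/2) log(1/δ)` blocks: radius `√(108σ₁² log(1/δ)/n + 486σ₂² log²(1/δ)/(n(2n − 9 log(1/δ))))`
at confidence `1 − δ`).  NEW WORK of the cell (elementary: our radius is stated through Hoeffding's
exact block variance, with the constants `1/4` and `e^{−R/8}` of the replica file); no definition is
introduced; nothing is cited as a fact.  The ℕ-indexed replica form of §1 is row 8's
`Scoring.measureReal_half_replicas_far_le` (`Scoring/ReplicaChains`, imported: its Chebyshev step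
`Scoring.measureReal_abs_sub_ge_le` is reused); §1 is its finite-index form (blocks are indexed by
`Fin R`), proved the same way.

## Content

* §1 `measureReal_half_far_le` — independent real `Y_r`, `r ∈ ι`, a finite `s ⊆ ι`, a target `c`:
  `P(t ≤ |Y_r − c|) ≤ 1/4` for `r ∈ s` ⇒ `P(#{r ∈ s : t ≤ |Y_r − c|} ≥ #s/2) ≤ exp(−#s/8)`;
  `measureReal_half_far_le_of_sq` — the same from `E(Y_r − c)² ≤ v`, `4v ≤ t²`, `t > 0`.
* §2 blocks of one stream: `mul_add_lt` (`r·m + i < n` for `r < R`, `i < m`, `R·m ≤ n`),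
  `mul_add_inj`, `iIndepFun_block` (each block is an independent family with the stream's laws),
  **`iIndepFun_blockUStat`** (the block U-statistics are mutually independent).
* §3 **`ustat₂_medianOfBlocks_confidence`** — `n` independent draws `x_i` with common law `ν`,
  symmetric `F ∈ L²(ν ⊗ ν)`, `m ≥ 2`, `R·m ≤ n`, `t > 0`, and any `v` with
  `V_m = (2(c₂ − μ_F²) + 4(m − 2)(c₁ − μ_F²))/(m(m − 1)) ≤ v`, `4v ≤ t²`:
  `P( #{r < R : t ≤ |U_r − μ_F|} ≥ R/2 ) ≤ exp(−R/8)`,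
  `U_r = Σ_{(i,j) ∈ offDiag(Fin m)} F(x_{rm+i}, x_{rm+j})/(m(m − 1))`, `μ_F = ∫ F d(ν ⊗ ν)`,
  `c₂ = ∫ F² d(ν ⊗ ν)`, `c₁ = ∫ (∫ F(a,b) dν(b))² dν(a)`; `…_confidence_exact` — with `v = V_m`.

Reading (value-free): `R ≈ 8 log(1/η)` blocks give confidence `1 − η` at radius `2√V_m`, and
`V_m ≤ 4ζ₁/m + 2ζ₂/m²·(1 + O(1/m))` is the U-statistic's OWN variance — for a well-trained flow the
projection variance `ζ₁` of the acceptance kernel is far below the squared weight ceiling that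
drives the Hoeffding radius (row 4's `Scoring/AllPairsAcceptanceCeilingFree` draws the ceiling-free
consequence).  NOT CLAIMED: the all-tuples (decoupled) estimator of Joly–Lugosi Thm 1 and its
constants; optimality of `1/4`, `1/8`; heavy tails beyond `L²` (their §3); a data-driven choice of
`t` (the radius is stated through `V_m`, an input); any number of ours re-scored.
-/

noncomputable section

namespace Summit.Ventures.LatticeQCDFlow.Scoring.BlockMedian

open MeasureTheory ProbabilityTheory Finset Real
open scoped NNReal

/-! ## §1 The median device over a finite index set -/

section Median

variable {Ω' : Type*} {mΩ' : MeasurableSpace Ω'} {μ : Measure Ω'} [IsProbabilityMeasure μ]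
variable {ι : Type*} {Y : ι → Ω' → ℝ}

/-- **MEDIAN OF INDEPENDENT ESTIMATES (confidence amplification, finite index set).**  For
mutually independent real random variables `Y_r`, `r ∈ ι`, a finite set `s` of indices and a target
`c`: if `P(t ≤ |Y_r − c|) ≤ 1/4` for every `r ∈ s`, then
`P(#{r ∈ s : t ≤ |Y_r − c|} ≥ #s/2) ≤ exp(−#s/8)` — on the complement strictly more than half of
the `Y_r`, `r ∈ s`, lie in `(c − t, c + t)`, hence so does every sample median.  (Finite-index form
of `Scoring.measureReal_half_replicas_far_le`.) [ours] -/
theorem measureReal_half_far_le (s : Finset ι) (hind : iIndepFun Y μ)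
    (hYm : ∀ r, Measurable (Y r)) (c t : ℝ)
    (hfar : ∀ r ∈ s, μ.real {ω | t ≤ |Y r ω - c|} ≤ 1 / 4) :
    μ.real {ω | (#s : ℝ) / 2 ≤ #{r ∈ s | t ≤ |Y r ω - c|}} ≤ exp (-(#s / 8)) := by
  classical
  -- the indicators of the bad events and their centred versions
  set I : ι → Ω' → ℝ := fun r ω => if t ≤ |Y r ω - c| then 1 else 0 with hI
  have hIm : ∀ r, Measurable (I r) := fun r =>
    Measurable.ite (measurableSet_le measurable_const ((hYm r).sub measurable_const).abs)
      measurable_const measurable_const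
  have hImem : ∀ r, ∀ᵐ ω ∂μ, I r ω ∈ Set.Icc (0 : ℝ) 1 := fun r => ae_of_all _ fun ω => by
    simp only [hI]; split_ifs <;> simp
  have hSm : ∀ r, MeasurableSet {ω | t ≤ |Y r ω - c|} := fun r =>
    measurableSet_le measurable_const ((hYm r).sub measurable_const).abs
  have hEI : ∀ r, μ[I r] = μ.real {ω | t ≤ |Y r ω - c|} := fun r => by
    have h : I r = Set.indicator {ω | t ≤ |Y r ω - c|} (fun _ => (1 : ℝ)) := by
      funext ω; simp only [hI, Set.indicator_apply, Set.mem_setOf_eq]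
    rw [h, integral_indicator (hSm r), setIntegral_const, smul_eq_mul, mul_one]
  set Z : ι → Ω' → ℝ := fun r ω => I r ω - μ[I r] with hZ
  have hZind : iIndepFun Z μ := by
    have h := hind.comp (fun r (y : ℝ) => (if t ≤ |y - c| then (1 : ℝ) else 0) - μ[I r])
      fun r => (Measurable.ite (measurableSet_le measurable_const
        (measurable_id.sub measurable_const).abs) measurable_const measurable_const).sub
        measurable_const
    exact h
  have hZsg : ∀ r ∈ s, HasSubgaussianMGF (Z r) ((‖(1 : ℝ) - 0‖₊ / 2) ^ 2) μ := fun r _ =>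
    hasSubgaussianMGF_of_mem_Icc (hIm r).aemeasurable (hImem r)
  have hc : (((‖(1 : ℝ) - 0‖₊ / 2) ^ 2 : ℝ≥0) : ℝ) = 1 / 4 := by
    rw [sub_zero, nnnorm_one]; push_cast; norm_num
  have hR0 : (0 : ℝ) ≤ #s / 4 := by positivity
  have hhoeff := HasSubgaussianMGF.measure_sum_ge_le_of_iIndepFun hZind (s := s) hZsg hR0
  have hsumc : (((∑ _r ∈ s, ((‖(1 : ℝ) - 0‖₊ / 2) ^ 2 : ℝ≥0)) : ℝ≥0) : ℝ) = #s * (1 / 4) := by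
    rw [sum_const, nsmul_eq_mul, NNReal.coe_mul, NNReal.coe_natCast, hc]
  rw [hsumc] at hhoeff
  -- the event `#bad ≥ #s/2` forces `Σ_{r ∈ s} Z_r ≥ #s/4`
  have hsub : {ω | (#s : ℝ) / 2 ≤ #{r ∈ s | t ≤ |Y r ω - c|}}
      ⊆ {ω | (#s : ℝ) / 4 ≤ ∑ r ∈ s, Z r ω} := by
    intro ω hω
    simp only [Set.mem_setOf_eq] at hω ⊢
    rw [natCast_card_filter] at hω
    have hsumI : ∑ r ∈ s, Z r ω = (∑ r ∈ s, I r ω) - ∑ r ∈ s, μ[I r] := by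
      rw [hZ]; simp only [Finset.sum_sub_distrib]
    have hsumE : ∑ r ∈ s, μ[I r] ≤ (#s : ℝ) / 4 := by
      calc ∑ r ∈ s, μ[I r] ≤ ∑ _r ∈ s, (1 / 4 : ℝ) :=
            Finset.sum_le_sum fun r hr => by rw [hEI r]; exact hfar r hr
        _ = (#s : ℝ) / 4 := by rw [Finset.sum_const, nsmul_eq_mul]; ring
    have hIω : ∑ r ∈ s, I r ω = ∑ r ∈ s, if t ≤ |Y r ω - c| then (1 : ℝ) else 0 := by
      rw [hI]
    rw [hsumI, hIω]
    linarith
  calc μ.real {ω | (#s : ℝ) / 2 ≤ #{r ∈ s | t ≤ |Y r ω - c|}}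
      ≤ μ.real {ω | (#s : ℝ) / 4 ≤ ∑ r ∈ s, Z r ω} := measureReal_mono hsub
    _ ≤ exp (-(#s / 4) ^ 2 / (2 * (#s * (1 / 4)))) := hhoeff
    _ ≤ exp (-(#s / 8)) := by
        rcases Nat.eq_zero_or_pos #s with h0 | hpos
        · rw [h0]; simp
        · have hRpos : (0 : ℝ) < #s := by exact_mod_cast hpos
          refine exp_le_exp.2 (le_of_eq ?_)
          field_simp
          ring

/-- The same device from second moments (Chebyshev about the target,
`Scoring.measureReal_abs_sub_ge_le` of `Scoring/ReplicaChains`): mutually independent `Y_r` with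
`E(Y_r − c)² ≤ v` for `r ∈ s` and a radius `t > 0` with `4v ≤ t²` ⇒
`P(#{r ∈ s : t ≤ |Y_r − c|} ≥ #s/2) ≤ exp(−#s/8)`. [ours] -/
theorem measureReal_half_far_le_of_sq (s : Finset ι) (hind : iIndepFun Y μ)
    (hYm : ∀ r, Measurable (Y r)) (hY : ∀ r ∈ s, MemLp (Y r) 2 μ) {c t v : ℝ} (ht : 0 < t)
    (hvt : 4 * v ≤ t ^ 2) (hv : ∀ r ∈ s, ∫ ω, (Y r ω - c) ^ 2 ∂μ ≤ v) :
    μ.real {ω | (#s : ℝ) / 2 ≤ #{r ∈ s | t ≤ |Y r ω - c|}} ≤ exp (-(#s / 8)) := by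
  refine measureReal_half_far_le s hind hYm c t fun r hr => ?_
  refine (measureReal_abs_sub_ge_le (hY r hr) c ht).trans ?_
  rw [div_le_iff₀ (pow_pos ht 2)]
  linarith [hv r hr]

end Median

/-! ## §2 Consecutive disjoint blocks of one stream -/

section Blocks

variable {n m R : ℕ}

/-- The stream index `r·m + i` of the `i`-th draw (`i < m`) of block `r` (`r < R`) is `< n` when
`R·m ≤ n`. [ours] -/
theorem mul_add_lt (hRm : R * m ≤ n) (r : Fin R) (i : Fin m) : (r : ℕ) * m + i < n := by
  have h1 : (r : ℕ) * m + i < ((r : ℕ) + 1) * m := by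
    rw [Nat.succ_mul]; exact Nat.add_lt_add_left i.isLt _
  exact lt_of_lt_of_le h1 ((Nat.mul_le_mul_right _ (Nat.succ_le_of_lt r.isLt)).trans hRm)

/-- Distinct (block, member) labels give distinct stream indices. [ours] -/
theorem mul_add_inj {r r' i i' : ℕ} (hi : i < m) (hi' : i' < m)
    (h : r * m + i = r' * m + i') : r = r' ∧ i = i' := by
  have hm : 0 < m := lt_of_le_of_lt (Nat.zero_le _) hi
  have key : ∀ {a b : ℕ}, b < m → (a * m + b) / m = a ∧ (a * m + b) % m = b := by
    intro a b hb
    refine ⟨?_, ?_⟩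
    · rw [Nat.mul_comm, Nat.mul_add_div hm, Nat.div_eq_of_lt hb, add_zero]
    · rw [Nat.mul_comm, Nat.mul_add_mod, Nat.mod_eq_of_lt hb]
  obtain ⟨h1, h2⟩ := key (a := r) hi
  obtain ⟨h3, h4⟩ := key (a := r') hi'
  rw [h] at h1 h2
  exact ⟨h1.symm.trans h3, h2.symm.trans h4⟩

variable {Ω : Type*} [MeasurableSpace Ω] {P : Measure Ω}
variable {X : Type*} [MeasurableSpace X] {ν : Measure X} {x : Fin n → Ω → X}

/-- **Each block of an independent stream is an independent family** (a sub-family along an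
injective re-indexing). [ours] -/
theorem iIndepFun_block (hind : iIndepFun x P) (hRm : R * m ≤ n) (r : Fin R) :
    iIndepFun (fun (i : Fin m) => x ⟨(r : ℕ) * m + i, mul_add_lt hRm r i⟩) P :=
  hind.precomp (g := fun i : Fin m => (⟨(r : ℕ) * m + i, mul_add_lt hRm r i⟩ : Fin n))
    fun i j hij => Fin.ext (mul_add_inj i.isLt j.isLt (congrArg Fin.val hij)).2

/-- **The block U-statistics of an independent stream are mutually independent** (grouping of
independent σ-fields along the pairwise disjoint blocks `{rm, …, rm + m − 1}`, `r < R`). [ours] -/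
theorem iIndepFun_blockUStat (hxm : ∀ i, Measurable (x i)) (hind : iIndepFun x P)
    (hRm : R * m ≤ n) {F : X → X → ℝ} (hFm : Measurable fun z : X × X => F z.1 z.2) :
    iIndepFun (fun (r : Fin R) ω =>
      (∑ z ∈ (univ : Finset (Fin m)).offDiag,
        F (x ⟨(r : ℕ) * m + z.1, mul_add_lt hRm r z.1⟩ ω)
          (x ⟨(r : ℕ) * m + z.2, mul_add_lt hRm r z.2⟩ ω)) / (m * (m - 1) : ℝ)) P := by
  have hg : Measurable (fun (y : Fin m → X) =>
      (∑ z ∈ (univ : Finset (Fin m)).offDiag, F (y z.1) (y z.2)) / (m * (m - 1) : ℝ)) := by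
    refine Measurable.div_const (Finset.measurable_sum _ fun (z : Fin m × Fin m) _ => ?_) _
    have h1 : Measurable (fun (y : Fin m → X) => (y z.1, y z.2)) :=
      (measurable_pi_apply z.1).prodMk (measurable_pi_apply z.2)
    exact hFm.comp h1
  have h := Literature.Probability.Independence.iIndepFun_comp_of_pairwise_disjoint hxm hind
    (α := fun _ : Fin R => Fin m)
    (fun r i => (⟨(r : ℕ) * m + (i : ℕ), mul_add_lt hRm r i⟩ : Fin n)) ?_
    (T := fun _ => ℝ)
    (fun _ (y : Fin m → X) =>
      (∑ z ∈ (univ : Finset (Fin m)).offDiag, F (y z.1) (y z.2)) / (m * (m - 1) : ℝ))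
    fun _ => hg
  · exact h
  · intro r r' hrr' i i' h
    exact hrr' (Fin.ext (mul_add_inj i.isLt i'.isLt (congrArg Fin.val h)).1)

end Blocks

/-! ## §3 The certificate -/

section Certificate

variable {Ω : Type*} [MeasurableSpace Ω] {P : Measure Ω} [IsProbabilityMeasure P]
variable {X : Type*} [MeasurableSpace X] {ν : Measure X}
variable {n m R : ℕ} {x : Fin n → Ω → X}

/-- **MEDIAN OF THE BLOCK U-STATISTICS (Joly–Lugosi's "diagonal blocks", order 2, with
Hoeffding's exact variance).**  `n` independent draws `x_i` with common law `ν`; a symmetric kernel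
`F ∈ L²(ν ⊗ ν)`; `m ≥ 2`, `R·m ≤ n`; `t > 0` and any `v` with
`(2(c₂ − μ_F²) + 4(m − 2)(c₁ − μ_F²))/(m(m − 1)) ≤ v` and `4v ≤ t²`.  Then, with
`U_r = Σ_{(i,j) ∈ offDiag} F(x_{rm+i}, x_{rm+j})/(m(m − 1))` the U-statistic of block `r < R`:
`P( #{r < R : t ≤ |U_r − μ_F|} ≥ R/2 ) ≤ exp(−R/8)` — except on that event, every sample median of
`U_0, …, U_{R−1}` is within `t` of `μ_F = ∫ F d(ν ⊗ ν)`.  No boundedness of `F` is assumed. [ours] -/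
theorem ustat₂_medianOfBlocks_confidence (hxm : ∀ i, Measurable (x i)) (hind : iIndepFun x P)
    (hlaw : ∀ i, Measure.map (x i) P = ν) {F : X → X → ℝ}
    (hFm : Measurable fun z : X × X => F z.1 z.2) (hF : ∀ a b, F a b = F b a)
    (hF2 : MemLp (fun z : X × X => F z.1 z.2) 2 (ν.prod ν)) (hm : 2 ≤ m) (hRm : R * m ≤ n)
    {t v : ℝ} (ht : 0 < t) (hvt : 4 * v ≤ t ^ 2)
    (hv : (2 * ((∫ z, F z.1 z.2 ^ 2 ∂(ν.prod ν)) - (∫ z, F z.1 z.2 ∂(ν.prod ν)) ^ 2)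
          + 4 * (m - 2) * ((∫ a, (∫ b, F a b ∂ν) ^ 2 ∂ν) - (∫ z, F z.1 z.2 ∂(ν.prod ν)) ^ 2))
        / (m * (m - 1)) ≤ v) :
    P.real {ω | (R : ℝ) / 2 ≤ #{r ∈ (univ : Finset (Fin R)) | t ≤
        |(∑ z ∈ (univ : Finset (Fin m)).offDiag,
            F (x ⟨((r : Fin R) : ℕ) * m + z.1, mul_add_lt hRm r z.1⟩ ω)
              (x ⟨((r : Fin R) : ℕ) * m + z.2, mul_add_lt hRm r z.2⟩ ω)) / (m * (m - 1))
          - ∫ z, F z.1 z.2 ∂(ν.prod ν)|}}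
      ≤ exp (-(R / 8)) := by
  have h := measureReal_half_far_le_of_sq (μ := P)
    (Y := fun (r : Fin R) ω =>
      (∑ z ∈ (univ : Finset (Fin m)).offDiag,
        F (x ⟨(r : ℕ) * m + z.1, mul_add_lt hRm r z.1⟩ ω)
          (x ⟨(r : ℕ) * m + z.2, mul_add_lt hRm r z.2⟩ ω)) / (m * (m - 1) : ℝ))
    (univ : Finset (Fin R)) (iIndepFun_blockUStat hxm hind hRm hFm)
    (fun r => measurable_ustat₂_iid (x := fun (i : Fin m) => x ⟨(r : ℕ) * m + i, mul_add_lt hRm r i⟩)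
      (fun i => hxm _) hFm)
    (fun r _ => memLp_ustat₂_iid (x := fun (i : Fin m) => x ⟨(r : ℕ) * m + i, mul_add_lt hRm r i⟩)
      (fun i => hxm _) (iIndepFun_block hind hRm r) (fun i => hlaw _) hF2)
    (c := ∫ z, F z.1 z.2 ∂(ν.prod ν)) ht hvt
    (fun r _ => le_of_eq_of_le
      (variance_ustat₂_eq_iid (x := fun (i : Fin m) => x ⟨(r : ℕ) * m + i, mul_add_lt hRm r i⟩)
        (fun i => hxm _) (iIndepFun_block hind hRm r) (fun i => hlaw _) hFm hF hF2 hm) hv)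
  simpa only [card_univ, Fintype.card_fin] using h

/-- The same with `v = V_m` itself: `4·(2(c₂ − μ_F²) + 4(m − 2)(c₁ − μ_F²))/(m(m − 1)) ≤ t²` ⇒
`P( #{r < R : t ≤ |U_r − μ_F|} ≥ R/2 ) ≤ exp(−R/8)`. [ours] -/
theorem ustat₂_medianOfBlocks_confidence_exact (hxm : ∀ i, Measurable (x i))
    (hind : iIndepFun x P) (hlaw : ∀ i, Measure.map (x i) P = ν) {F : X → X → ℝ}
    (hFm : Measurable fun z : X × X => F z.1 z.2) (hF : ∀ a b, F a b = F b a)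
    (hF2 : MemLp (fun z : X × X => F z.1 z.2) 2 (ν.prod ν)) (hm : 2 ≤ m) (hRm : R * m ≤ n)
    {t : ℝ} (ht : 0 < t)
    (hvt : 4 * ((2 * ((∫ z, F z.1 z.2 ^ 2 ∂(ν.prod ν)) - (∫ z, F z.1 z.2 ∂(ν.prod ν)) ^ 2)
          + 4 * (m - 2) * ((∫ a, (∫ b, F a b ∂ν) ^ 2 ∂ν) - (∫ z, F z.1 z.2 ∂(ν.prod ν)) ^ 2))
        / (m * (m - 1))) ≤ t ^ 2) :
    P.real {ω | (R : ℝ) / 2 ≤ #{r ∈ (univ : Finset (Fin R)) | t ≤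
        |(∑ z ∈ (univ : Finset (Fin m)).offDiag,
            F (x ⟨((r : Fin R) : ℕ) * m + z.1, mul_add_lt hRm r z.1⟩ ω)
              (x ⟨((r : Fin R) : ℕ) * m + z.2, mul_add_lt hRm r z.2⟩ ω)) / (m * (m - 1))
          - ∫ z, F z.1 z.2 ∂(ν.prod ν)|}}
      ≤ exp (-(R / 8)) :=
  ustat₂_medianOfBlocks_confidence hxm hind hlaw hFm hF hF2 hm hRm ht hvt le_rfl

end Certificate

end Summit.Ventures.LatticeQCDFlow.Scoring.BlockMedian

end
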